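import Summits.NavierStokesRegularity.NavierStokesRegularity.Theorems.ThreadingFluxCentreVirialHodgeShell
import Summits.NavierStokesRegularity.NavierStokesRegularity.Theorems.ThreadingFluxCentreVirialHodgeDefect
import HarnessLib

/-!
# Hodge slaving, sphere-free — VI: the shell inequality WITH VORTICITY DEFECT

`shell_bochner_ineq_defect`: for `W ∈ C²(ℝ³; ℝ³)` tangential about `x₀` and `0 < a < b`,
`∫_{a<|y|<b} |W|²/|y|³ ≤ ½∫_{a<|y|<b} (div W)²/|y| + ½∫_{a<|y|<b} ⟪curl W, y⟫²/|y|³` — part V with the smooth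
approximants `kapApprox` of part IV and dominated convergence (three sequences).  No unthreadedness is assumed; the
defect vanishes on unthreaded fields and tends to zero under mollification, which is how H is transported to `C¹` fields.

Part of the sphere-free proof of Hodge slaving (H of the centre-virial card, ns-idea-15 g9; twin
`ThreadingFluxCentreVirialDefs`).  Folklore analysis re-derived in ambient coordinates; information-grade; W1 movement 0;
`PoloidalLiouville` (1222), T0, Galdi's problem OPEN; NS regularity is NOT proved.
`--supports stmt-NavierStokesRegularity-1222 --as helper`.  Filed by ns-wall-eng-4 g6 (cell ns-wall-extremal).
[cite: KorobkovPileckasRusso2015, Thm 3.6]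
-/

-- the summit and its single sub-problem share the name (CONVENTIONS §1)
set_option linter.dupNamespace false

noncomputable section

namespace Summit.NavierStokesRegularity.NavierStokesRegularity.Theorems.PoloidalLiouville.CentreVirial

open Set Function MeasureTheory Filter Topology
open Literature.Analysis.FluidPDE
open Literature.Analysis.FluidPDE.VectorCalculus (divergence IsDivFree)
open Summit.NavierStokesRegularity.NavierStokesRegularity.Theorems.PoloidalLiouville.CentreJet
  (E3 IsUnthreadedAbout IsSteadyNSOn)
open scoped RealInnerProductSpace

namespace Hodge

/-- ★ **The shell inequality with vorticity defect** (no unthreadedness): `∫_A |W|²/|y|³ ≤ ½∫_A (div W)²/|y| + ½∫_A ⟪curl W, y⟫²/|y|³`.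
Companion of the unthreaded version: for `W ∈ C²(ℝ³; ℝ³)` tangential about `x₀`
and unthreaded off `x₀`, and `0 < a < b`,
`∫_{a<|y|<b} |W|²/|y|³ ≤ ½ ∫_{a<|y|<b} (div W)²/|y|`. -/
theorem shell_bochner_ineq_defect {W : E3 → E3} {x₀ : E3} (hW : ContDiff ℝ 2 W) (htan : ∀ z, ⟪W z, z - x₀⟫ = 0)
    {a b : ℝ} (ha : 0 < a) (hab : a < b) :
    ∫ x in {x | a < ‖x - x₀‖ ∧ ‖x - x₀‖ < b}, ‖W x‖ ^ 2 / ‖x - x₀‖ ^ 3 ≤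
      ((1 / 2) * ∫ x in {x | a < ‖x - x₀‖ ∧ ‖x - x₀‖ < b}, divergence W x ^ 2 / ‖x - x₀‖) +
        (1 / 2) * ∫ x in {x | a < ‖x - x₀‖ ∧ ‖x - x₀‖ < b}, ⟪curl W x, x - x₀⟫ ^ 2 / ‖x - x₀‖ ^ 3 := by
  set α : ℝ := a ^ 2 with hα_def
  set β : ℝ := b ^ 2 with hβ_def
  have hb : 0 < b := ha.trans hab
  have hα : 0 < α := by positivity
  set A : Set E3 := {x | a < ‖x - x₀‖ ∧ ‖x - x₀‖ < b} with hA_def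
  have hAm : MeasurableSet A := by
    have : A = Metric.ball x₀ b \ Metric.closedBall x₀ a := by
      ext x; simp [hA_def, Metric.mem_closedBall, Metric.mem_ball, dist_eq_norm, and_comm]
    rw [this]
    exact Metric.isOpen_ball.measurableSet.diff Metric.isClosed_closedBall.measurableSet
  have hmemA : ∀ x : E3, x ∈ A ↔ ‖x - x₀‖ ^ 2 ∈ Set.Ioo α β := by
    intro x
    rw [hA_def, Set.mem_setOf_eq, Set.mem_Ioo, hα_def, hβ_def,
      pow_lt_pow_iff_left₀ ha.le (norm_nonneg _) two_ne_zero, pow_lt_pow_iff_left₀ (norm_nonneg _) hb.le two_ne_zero]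
  -- the smooth-weight inequalities
  have hn : ∀ n : ℕ, ∫ x, kapApprox α β n (‖x - x₀‖ ^ 2) * (‖W x‖ ^ 2 / ‖x - x₀‖ ^ 2) ≤
      ((1 / 2) * ∫ x, kapApprox α β n (‖x - x₀‖ ^ 2) * divergence W x ^ 2) +
        (1 / 2) * ∫ x, kapApprox α β n (‖x - x₀‖ ^ 2) * (⟪curl W x, x - x₀⟫ ^ 2 / ‖x - x₀‖ ^ 2) := fun n =>
    weighted_bochner_ineq_defect hW htan (kapApprox_contDiff hα n) hα (fun σ hσ => kapApprox_eq_zero_of_le n hσ)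
      (fun σ hσ => kapApprox_eq_zero_of_ge n hσ) (kapApprox_nonneg α β n)
  have hcurlc : Continuous (curl W) := by
    rw [curl_eq_curlCLM_comp]
    exact curlCLM.continuous.comp (hW.continuous_fderiv (by norm_num))
  have hcyc : Continuous fun x : E3 => ⟪curl W x, x - x₀⟫ ^ 2 := (hcurlc.inner (continuous_id.sub continuous_const)).pow 2
  -- continuity data
  have hWc : Continuous W := hW.continuous
  have hdivWc : Continuous (divergence W) := continuous_divergence (hW.continuous_fderiv (by norm_num))
  have hnsq : Continuous fun x : E3 => ‖x - x₀‖ ^ 2 := (continuous_norm.comp (continuous_id.sub continuous_const)).pow 2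
  have hnc : Continuous fun x : E3 => ‖x - x₀‖ := continuous_norm.comp (continuous_id.sub continuous_const)
  -- compact closed shell carrying everything
  set K : Set E3 := Metric.closedBall x₀ b \ Metric.ball x₀ a with hK_def
  have hK : IsCompact K := (isCompact_closedBall x₀ b).diff Metric.isOpen_ball
  have hKm : MeasurableSet K := Metric.isClosed_closedBall.measurableSet.diff Metric.isOpen_ball.measurableSet
  have hr0 : ∀ x ∈ K, ‖x - x₀‖ ≠ 0 := by
    intro x hx
    simp only [hK_def, Set.mem_sdiff, Metric.mem_ball, dist_eq_norm, not_lt] at hx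
    exact (ha.trans_le hx.2).ne'
  have hzero_off : ∀ (n : ℕ) (x : E3), x ∉ K → kapApprox α β n (‖x - x₀‖ ^ 2) = 0 := by
    intro n x hx
    simp only [hK_def, Set.mem_sdiff, Metric.mem_closedBall, Metric.mem_ball, dist_eq_norm, not_and, not_not] at hx
    by_cases h : ‖x - x₀‖ ≤ b
    · have : ‖x - x₀‖ < a := hx h
      exact kapApprox_eq_zero_of_le n (by rw [hα_def]; exact pow_le_pow_left₀ (norm_nonneg _) this.le 2)
    · exact kapApprox_eq_zero_of_ge n (by rw [hβ_def]; exact pow_le_pow_left₀ hb.le (not_le.1 h).le 2)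
  set C : ℝ := (Real.sqrt (α / 2))⁻¹ with hC_def
  have hC : 0 ≤ C := by positivity
  -- limit of the left-hand sides
  have hL : Tendsto (fun n : ℕ => ∫ x, kapApprox α β n (‖x - x₀‖ ^ 2) * (‖W x‖ ^ 2 / ‖x - x₀‖ ^ 2)) atTop
      (𝓝 (∫ x, A.indicator (fun x => ‖W x‖ ^ 2 / ‖x - x₀‖ ^ 3) x)) := by
    refine tendsto_integral_of_dominated_convergence
      (fun x => K.indicator (fun x => C * (‖W x‖ ^ 2 / ‖x - x₀‖ ^ 2)) x) ?_ ?_ ?_ ?_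
    · intro n
      refine (Continuous.aestronglyMeasurable ?_)
      have hf : ContDiffOn ℝ 0 (fun x => ‖W x‖ ^ 2 / ‖x - x₀‖ ^ 2) {x₀}ᶜ := by
        rw [contDiffOn_zero]
        exact (hWc.norm.pow 2).continuousOn.div (hnc.pow 2).continuousOn fun x hx =>
          pow_ne_zero 2 (norm_ne_zero_iff.2 (sub_ne_zero.2 hx))
      have hg : ContDiff ℝ 0 fun x : E3 => kapApprox α β n (‖x - x₀‖ ^ 2) :=
        ((kapApprox_contDiff hα n).of_le (by norm_num)).comp ((contDiff_id.sub contDiff_const).norm_sq ℝ)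
      exact contDiff_zero.1 (contDiff_smul_of_vanishing (n := 0) (F := ℝ) (Real.sqrt_pos.2 hα) hg
        (fun x hx => radialProfile_eq_zero_of_mem_ball (fun σ hσ => kapApprox_eq_zero_of_le n hσ) hx) hf)
    · refine ((continuousOn_const.mul ((hWc.norm.pow 2).continuousOn.div (hnc.pow 2).continuousOn fun x hx =>
        pow_ne_zero 2 (hr0 x hx))).integrableOn_compact hK).integrable_indicator hKm
    · intro n
      refine Eventually.of_forall fun x => ?_
      by_cases hx : x ∈ K
      · rw [Set.indicator_of_mem hx, Real.norm_eq_abs, abs_mul, abs_of_nonneg (kapApprox_nonneg _ _ _ _),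
          abs_of_nonneg (by positivity)]
        exact mul_le_mul_of_nonneg_right (kapApprox_le hα n _) (by positivity)
      · rw [Set.indicator_of_notMem hx, hzero_off n x hx, zero_mul, norm_zero]
    · refine Eventually.of_forall fun x => ?_
      have h := (tendsto_kapApprox (β := β) hα (‖x - x₀‖ ^ 2)).mul_const (‖W x‖ ^ 2 / ‖x - x₀‖ ^ 2)
      refine h.congr' (Eventually.of_forall fun n => rfl) |>.trans ?_
      by_cases hx : x ∈ A
      · rw [Set.indicator_of_mem hx, Set.indicator_of_mem ((hmemA x).1 hx), Real.sqrt_sq (norm_nonneg _)]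
        have hr : ‖x - x₀‖ ≠ 0 := (ha.trans hx.1).ne'
        rw [show ‖W x‖ ^ 2 / ‖x - x₀‖ ^ 3 = (‖x - x₀‖)⁻¹ * (‖W x‖ ^ 2 / ‖x - x₀‖ ^ 2) by field_simp]
      · have hx' : ‖x - x₀‖ ^ 2 ∉ Set.Ioo α β := fun h => hx ((hmemA x).2 h)
        rw [Set.indicator_of_notMem hx, Set.indicator_of_notMem hx', zero_mul]
  -- limit of the right-hand sides
  have hR : Tendsto (fun n : ℕ => (1 / 2) * ∫ x, kapApprox α β n (‖x - x₀‖ ^ 2) * divergence W x ^ 2) atTop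
      (𝓝 ((1 / 2) * ∫ x, A.indicator (fun x => divergence W x ^ 2 / ‖x - x₀‖) x)) := by
    refine (tendsto_integral_of_dominated_convergence
      (fun x => K.indicator (fun x => C * divergence W x ^ 2) x) ?_ ?_ ?_ ?_).const_mul (1 / 2)
    · intro n
      exact ((((kapApprox_contDiff hα n).continuous).comp hnsq).mul (hdivWc.pow 2)).aestronglyMeasurable
    · exact ((continuous_const.mul (hdivWc.pow 2)).continuousOn.integrableOn_compact hK).integrable_indicator hKm
    · intro n
      refine Eventually.of_forall fun x => ?_
      by_cases hx : x ∈ K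
      · rw [Set.indicator_of_mem hx, Real.norm_eq_abs, abs_mul, abs_of_nonneg (kapApprox_nonneg _ _ _ _),
          abs_of_nonneg (sq_nonneg _)]
        exact mul_le_mul_of_nonneg_right (kapApprox_le hα n _) (sq_nonneg _)
      · rw [Set.indicator_of_notMem hx, hzero_off n x hx, zero_mul, norm_zero]
    · refine Eventually.of_forall fun x => ?_
      have h := (tendsto_kapApprox (β := β) hα (‖x - x₀‖ ^ 2)).mul_const (divergence W x ^ 2)
      refine h.congr' (Eventually.of_forall fun n => rfl) |>.trans ?_
      by_cases hx : x ∈ A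
      · rw [Set.indicator_of_mem hx, Set.indicator_of_mem ((hmemA x).1 hx), Real.sqrt_sq (norm_nonneg _)]
        have hr : ‖x - x₀‖ ≠ 0 := (ha.trans hx.1).ne'
        rw [show divergence W x ^ 2 / ‖x - x₀‖ = (‖x - x₀‖)⁻¹ * divergence W x ^ 2 by field_simp]
      · have hx' : ‖x - x₀‖ ^ 2 ∉ Set.Ioo α β := fun h => hx ((hmemA x).2 h)
        rw [Set.indicator_of_notMem hx, Set.indicator_of_notMem hx', zero_mul]
  have hD : Tendsto (fun n : ℕ => (1 / 2) * ∫ x, kapApprox α β n (‖x - x₀‖ ^ 2) * (⟪curl W x, x - x₀⟫ ^ 2 / ‖x - x₀‖ ^ 2))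
      atTop (𝓝 ((1 / 2) * ∫ x, A.indicator (fun x => ⟪curl W x, x - x₀⟫ ^ 2 / ‖x - x₀‖ ^ 3) x)) := by
    refine (tendsto_integral_of_dominated_convergence
      (fun x => K.indicator (fun x => C * (⟪curl W x, x - x₀⟫ ^ 2 / ‖x - x₀‖ ^ 2)) x) ?_ ?_ ?_ ?_).const_mul (1 / 2)
    · intro n
      refine (Continuous.aestronglyMeasurable ?_)
      have hf : ContDiffOn ℝ 0 (fun x => ⟪curl W x, x - x₀⟫ ^ 2 / ‖x - x₀‖ ^ 2) {x₀}ᶜ := by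
        rw [contDiffOn_zero]
        exact hcyc.continuousOn.div (hnc.pow 2).continuousOn fun x hx =>
          pow_ne_zero 2 (norm_ne_zero_iff.2 (sub_ne_zero.2 hx))
      have hg : ContDiff ℝ 0 fun x : E3 => kapApprox α β n (‖x - x₀‖ ^ 2) :=
        ((kapApprox_contDiff hα n).of_le (by norm_num)).comp ((contDiff_id.sub contDiff_const).norm_sq ℝ)
      exact contDiff_zero.1 (contDiff_smul_of_vanishing (n := 0) (F := ℝ) (Real.sqrt_pos.2 hα) hg
        (fun x hx => radialProfile_eq_zero_of_mem_ball (fun σ hσ => kapApprox_eq_zero_of_le n hσ) hx) hf)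
    · refine ((continuousOn_const.mul (hcyc.continuousOn.div (hnc.pow 2).continuousOn fun x hx =>
        pow_ne_zero 2 (hr0 x hx))).integrableOn_compact hK).integrable_indicator hKm
    · intro n
      refine Eventually.of_forall fun x => ?_
      by_cases hx : x ∈ K
      · rw [Set.indicator_of_mem hx, Real.norm_eq_abs, abs_mul, abs_of_nonneg (kapApprox_nonneg _ _ _ _),
          abs_of_nonneg (by positivity)]
        exact mul_le_mul_of_nonneg_right (kapApprox_le hα n _) (by positivity)
      · rw [Set.indicator_of_notMem hx, hzero_off n x hx, zero_mul, norm_zero]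
    · refine Eventually.of_forall fun x => ?_
      have h := (tendsto_kapApprox (β := β) hα (‖x - x₀‖ ^ 2)).mul_const (⟪curl W x, x - x₀⟫ ^ 2 / ‖x - x₀‖ ^ 2)
      refine h.congr' (Eventually.of_forall fun n => rfl) |>.trans ?_
      by_cases hx : x ∈ A
      · rw [Set.indicator_of_mem hx, Set.indicator_of_mem ((hmemA x).1 hx), Real.sqrt_sq (norm_nonneg _)]
        have hr : ‖x - x₀‖ ≠ 0 := (ha.trans hx.1).ne'
        rw [show ⟪curl W x, x - x₀⟫ ^ 2 / ‖x - x₀‖ ^ 3 = (‖x - x₀‖)⁻¹ * (⟪curl W x, x - x₀⟫ ^ 2 / ‖x - x₀‖ ^ 2) by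
          field_simp]
      · have hx' : ‖x - x₀‖ ^ 2 ∉ Set.Ioo α β := fun h => hx ((hmemA x).2 h)
        rw [Set.indicator_of_notMem hx, Set.indicator_of_notMem hx', zero_mul]
  have hle := le_of_tendsto_of_tendsto' hL (hR.add hD) hn
  rw [integral_indicator hAm, integral_indicator hAm, integral_indicator hAm] at hle
  exact hle



end Hodge

end Summit.NavierStokesRegularity.NavierStokesRegularity.Theorems.PoloidalLiouville.CentreVirial
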